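import Mathlib

/-!
# Two-spin block: curve form of the characteristic polynomial and the exact saddle values

[cite: ImbrieJSP2016, eq. (1.1), §4.2.1 (block Hamiltonians of resonant blocks)]

For the interacting two-spin block `H = h₁Z₁ + h₂Z₂ + JZ₁Z₂ + t₁X₁ + t₂X₂` put `x = E − h₂`,
`y = E + h₂`, `ρ₊² = (h₁+J)² + t₁²`, `ρ₋² = (h₁−J)² + t₁²`, `κ = h₁² − J² + t₁²` and
`P(x,y) = (x² − ρ₊²)(y² − ρ₋²) − 2t₂²(κ + xy) + t₂⁴`.

* `twoSpin_curve_form`: `P(E − h₂, E + h₂) = E⁴ − 2S·E² − 8h₁h₂J·E + (S² − 4Q)`, the quartic whose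
  coefficients are the ones fixed by the power sums of `TwoSpinPairing` (`tr H² = 4S`,
  `tr H³ = 24h₁h₂J`, `e₄ = S² − 4Q`); so the spectrum at field `h₂` is the intersection of the
  FIXED real curve `P = 0` with the moving line `y − x = 2h₂`.
* `twoSpin_curve_discriminant`: `ρ₊²ρ₋² − κ² = 4J²t₁²`.
* `twoSpin_saddle_product`, `twoSpin_saddle_ratio`, `twoSpin_saddle_value`: at a critical point of
  `P` with `x ≠ 0` one has `(x²−ρ₊²)(y²−ρ₋²) = t₂⁴`, `y²ρ₊² = x²ρ₋²` and `P = 2t₂²(t₂² − κ − xy)`.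
* `twoSpin_saddle_value_branch`: on the branch `ρ₊y = −ρ₋x` (the near-nodes of the MIDDLE gap)
  the critical value satisfies `P·(ρ₊ρ₋ + κ) = 8J²t₁²t₂²`; it vanishes iff `J t₁ t₂ = 0`
  (re-deriving the degeneracy locus of `TwoSpinDegeneracy`) and it is the squared NECK WIDTH of the
  avoided crossing: `min_{h₂} (E₃ − E₂) ≈ 2√(2P*/|∂ᵥ²P|)`, `∂ᵥ²P = −8ρ₊ρ₋ − 2t₂²(ρ₊−ρ₋)²/(ρ₊ρ₋)`
  (audit cell pub-imbrie, LLA.md gen-6 block N10; numerically exact to 10⁻⁴ relative).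
These are audit lemmas; they neither prove nor disprove LLA.
-/

namespace Literature.MathematicalPhysics.QuantumLattice.Imbrie2016

/-- [cite: ImbrieJSP2016, eq. (1.1), §4.2.1] Curve form of the two-spin characteristic quartic. -/
theorem twoSpin_curve_form (h₁ h₂ J t₁ t₂ E : ℝ) :
    ((E - h₂) ^ 2 - ((h₁ + J) ^ 2 + t₁ ^ 2)) * ((E + h₂) ^ 2 - ((h₁ - J) ^ 2 + t₁ ^ 2))
      - 2 * t₂ ^ 2 * ((h₁ ^ 2 - J ^ 2 + t₁ ^ 2) + (E - h₂) * (E + h₂)) + t₂ ^ 4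
    = E ^ 4 - 2 * (h₁ ^ 2 + h₂ ^ 2 + J ^ 2 + t₁ ^ 2 + t₂ ^ 2) * E ^ 2 - 8 * h₁ * h₂ * J * E
      + ((h₁ ^ 2 + h₂ ^ 2 + J ^ 2 + t₁ ^ 2 + t₂ ^ 2) ^ 2
        - 4 * (h₁ ^ 2 * h₂ ^ 2 + h₂ ^ 2 * J ^ 2 + h₂ ^ 2 * t₁ ^ 2 + h₁ ^ 2 * J ^ 2
              + h₁ ^ 2 * t₂ ^ 2 + t₁ ^ 2 * t₂ ^ 2)) := by
  ring

/-- [cite: ImbrieJSP2016, eq. (1.1), §4.2.1] `ρ₊²ρ₋² − κ² = 4J²t₁²`. -/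
theorem twoSpin_curve_discriminant (h₁ J t₁ : ℝ) :
    ((h₁ + J) ^ 2 + t₁ ^ 2) * ((h₁ - J) ^ 2 + t₁ ^ 2) - (h₁ ^ 2 - J ^ 2 + t₁ ^ 2) ^ 2
      = 4 * J ^ 2 * t₁ ^ 2 := by
  ring

/-- [cite: ImbrieJSP2016, eq. (1.1), §4.2.1] At a critical point of `P` (`∂ₓP = ∂ᵧP = 0`, written
as `hx'`, `hy'`) with `x ≠ 0`: `(x²−ρ₊²)(y²−ρ₋²) = t₂⁴`. Here `a = ρ₊²`, `b = ρ₋²`. -/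
theorem twoSpin_saddle_product (a b t₂ x y : ℝ) (hx : x ≠ 0)
    (hx' : x * (y ^ 2 - b) - t₂ ^ 2 * y = 0) (hy' : y * (x ^ 2 - a) - t₂ ^ 2 * x = 0) :
    (x ^ 2 - a) * (y ^ 2 - b) = t₂ ^ 4 := by
  have h : x * ((x ^ 2 - a) * (y ^ 2 - b) - t₂ ^ 4) = 0 := by
    linear_combination (x ^ 2 - a) * hx' + t₂ ^ 2 * hy'
  rcases mul_eq_zero.mp h with h0 | h0
  · exact absurd h0 hx
  · linarith

/-- [cite: ImbrieJSP2016, eq. (1.1), §4.2.1] At a critical point of `P`: `y²ρ₊² = x²ρ₋²`. -/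
theorem twoSpin_saddle_ratio (a b t₂ x y : ℝ)
    (hx' : x * (y ^ 2 - b) - t₂ ^ 2 * y = 0) (hy' : y * (x ^ 2 - a) - t₂ ^ 2 * x = 0) :
    y ^ 2 * a = x ^ 2 * b := by
  linear_combination x * hx' - y * hy'

/-- [cite: ImbrieJSP2016, eq. (1.1), §4.2.1] Critical value of `P` at a critical point with
`x ≠ 0`: `P = 2t₂²(t₂² − κ − xy)`. -/
theorem twoSpin_saddle_value (a b κ t₂ x y : ℝ) (hx : x ≠ 0)
    (hx' : x * (y ^ 2 - b) - t₂ ^ 2 * y = 0) (hy' : y * (x ^ 2 - a) - t₂ ^ 2 * x = 0) :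
    (x ^ 2 - a) * (y ^ 2 - b) - 2 * t₂ ^ 2 * (κ + x * y) + t₂ ^ 4
      = 2 * t₂ ^ 2 * (t₂ ^ 2 - κ - x * y) := by
  have h := twoSpin_saddle_product a b t₂ x y hx hx' hy'
  linear_combination h

/-- [cite: ImbrieJSP2016, eq. (1.1), §4.2.1] Exact saddle value on the middle-gap branch
`ρ₊y = −ρ₋x`: `P* · (ρ₊ρ₋ + κ) = 8J²t₁²t₂²`. Hypotheses: `ρ₊ ≠ 0, ρ₋` square to the sector
radii, `x ≠ 0`, the branch relation and the criticality equation `∂ᵧP = 0`. -/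
theorem twoSpin_saddle_value_branch (h₁ J t₁ t₂ ρp ρm x y : ℝ)
    (hρp : ρp ^ 2 = (h₁ + J) ^ 2 + t₁ ^ 2) (hρm : ρm ^ 2 = (h₁ - J) ^ 2 + t₁ ^ 2)
    (hp : ρp ≠ 0) (hx : x ≠ 0) (hb : ρp * y = -(ρm * x))
    (hy' : y * (x ^ 2 - ρp ^ 2) - t₂ ^ 2 * x = 0) :
    ((x ^ 2 - ρp ^ 2) * (y ^ 2 - ρm ^ 2) - 2 * t₂ ^ 2 * ((h₁ ^ 2 - J ^ 2 + t₁ ^ 2) + x * y)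
        + t₂ ^ 4) * (ρp * ρm + (h₁ ^ 2 - J ^ 2 + t₁ ^ 2)) = 8 * J ^ 2 * t₁ ^ 2 * t₂ ^ 2 := by
  -- from the branch relation and criticality: ρm (x² − ρp²) = −t₂² ρp  (uses x ≠ 0, ρp ≠ 0)
  have h1 : x * (ρm * (x ^ 2 - ρp ^ 2) + t₂ ^ 2 * ρp) = 0 := by
    have : ρp * (y * (x ^ 2 - ρp ^ 2) - t₂ ^ 2 * x) = 0 := by rw [hy']; ring
    linear_combination -this + (x ^ 2 - ρp ^ 2) * hb
  have h2 : ρm * (x ^ 2 - ρp ^ 2) + t₂ ^ 2 * ρp = 0 := by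
    rcases mul_eq_zero.mp h1 with h0 | h0
    · exact absurd h0 hx
    · exact h0
  -- y = -(ρm/ρp) x, so x*y*ρp = -ρm x² and y² ρp² = ρm² x²
  have h3 : ρp * (x * y) = -(ρm * x ^ 2) := by linear_combination x * hb
  have h4 : ρp ^ 2 * y ^ 2 = ρm ^ 2 * x ^ 2 := by linear_combination (ρp * y - ρm * x) * hb
  -- Work with everything multiplied by ρp² to avoid division; ρp ≠ 0 lets us cancel at the end.
  have key : ρp ^ 2 * (((x ^ 2 - ρp ^ 2) * (y ^ 2 - ρm ^ 2)
      - 2 * t₂ ^ 2 * ((h₁ ^ 2 - J ^ 2 + t₁ ^ 2) + x * y) + t₂ ^ 4)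
      * (ρp * ρm + (h₁ ^ 2 - J ^ 2 + t₁ ^ 2))) = ρp ^ 2 * (8 * J ^ 2 * t₁ ^ 2 * t₂ ^ 2) := by
    linear_combination ((ρp * ρm + (h₁ ^ 2 - J ^ 2 + t₁ ^ 2)) * (x ^ 2 - ρp ^ 2)) * h4
      + (-(2 * t₂ ^ 2 * ρp * (ρp * ρm + (h₁ ^ 2 - J ^ 2 + t₁ ^ 2)))) * h3
      + ((ρp * ρm + (h₁ ^ 2 - J ^ 2 + t₁ ^ 2)) * (ρm * (x ^ 2 - ρp ^ 2) + t₂ ^ 2 * ρp)) * h2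
      + (2 * t₂ ^ 2 * ρp ^ 2 * ρm ^ 2) * hρp
      + (2 * t₂ ^ 2 * ρp ^ 2 * ((h₁ + J) ^ 2 + t₁ ^ 2)) * hρm
  have hp2 : ρp ^ 2 ≠ 0 := pow_ne_zero 2 hp
  exact mul_left_cancel₀ hp2 key

end Literature.MathematicalPhysics.QuantumLattice.Imbrie2016
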